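import Mathlib
import Summits.NavierStokesRegularity.NavierStokesRegularity.Theorems.EulerZoomLiouvillePowerGaugeEulerLiouvilleSelfSimilarShiftedUniformlyContinuous
import Summits.NavierStokesRegularity.NavierStokesRegularity.Theorems.EulerZoomLiouvillePowerGaugeEulerLiouvilleSelfSimilarSubdriftLoc
import Literature.Analysis.FluidPDE.HarmonicLiouvilleGrowth
import Literature.Analysis.FluidPDE.CurlFreeLiouville
import Literature.Analysis.FluidPDE.NSBoundedMildOseenClassical
import HarnessLib

/-!
# Rung C1 of the crux `EulerZoomLiouville.PowerGaugeEulerLiouville`: an IRROTATIONAL `C²` profile is killed by the `A`-gauge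
# WITHOUT ANY GROWTH HYPOTHESIS; the SHIFTED sub-drift stratum
# (crux E = stmt-NavierStokesRegularity-19832, line `birth`, rung C1)

Route №10 `EulerZoomLiouville` (NavierStokesRegularity).  Interim LEAD ns-typeII-p2 g9, complementing ns-typeII-p1 g8's sub-drift
lever (`…SelfSimilarSubdriftLoc`: a `C²` self-similar Euler profile with `‖U y‖ ≤ κ‖y‖` near infinity, `κ < γ`, is IRROTATIONAL;
`…SelfSimilarSubdriftRigidity`: hence affine, and the centred member vanishes).

(1) THE ENDGAME NEEDS NO GROWTH HYPOTHESIS.  Once `curl V = 0` is known, `div V = 0` makes every component of `V` harmonic, and a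
harmonic function whose `L²`-mass in balls grows slower than the volume vanishes (growth form of Liouville's theorem,
`HarmonicOnNhd.eq_zero_of_lintegral_sq_le`, `Literature/…/HarmonicLiouvilleGrowth`, mean value inequality); the member's `A`-gauge
gives exactly such a bound for the profile, `∫_{B_L}‖V‖² ≤ c L^{1−2ρ}` (`profile_energy_growth_of_gaugeA`; `1 − 2ρ < 3`).  Hence
**an exactly self-similar member whose velocity profile is `C²` (indeed `C¹` would do) and IRROTATIONAL is trivial, whatever the
growth of the profile** (`Loc.selfSimilar_ae_eq_zero_of_irrotationalC2_profile`; no pressure is involved: `div V = 0` comes from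
the weak divergence-freeness of the member).  This separates the crux's classical residue cleanly into a DYNAMICAL statement
(«the profile is irrotational» — where the sub-drift barrier is the current frontier) and a finished endgame; p1 g8's affine
route needs the linear growth, this one does not.
(2) THE SHIFTED SUB-DRIFT STRATUM.  For members exactly self-similar about ANY `(T, x₀)`, `T ≥ 0`
(`Shifted.isDistributional_selfSimilarCollapse_of_shifted`), the same holds with the large-scale `A`-gauge reading
`Shifted.profile_energy_growth_of_gaugeA` (`0 < ρ ≤ ½`): `Shifted.selfSimilar_ae_eq_zero_of_irrotationalC2_profile`, and with
p1 g8's `Loc.curl_eq_zero_of_subdrift`, `Shifted.selfSimilar_ae_eq_zero_of_subdriftC2_profile` (`limsup ‖V(y)‖/‖y‖ < γ` ⇒ trivial),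
which contains the shifted sublinear / uniformly continuous / bounded strata.

* `Loc.eq_zero_of_curl_eq_zero_of_growth` — `V ∈ C²(ℝ³; ℝ³)`, `curl V = 0`, `div V = 0`, `∫⁻_{B_L}‖V‖ₑ² ≤ C·L^θ` (`C < ∞`,
  `θ < 3`) ⇒ `V = 0`;
* `Loc.selfSimilar_ae_eq_zero_of_irrotationalC2_profile` — MEMBER LEVEL (centred), `0 < ρ`: distributional Euler pair +
  `A`-gauge + exact self-similarity + `V ∈ C²`, `curl V ≡ 0` ⇒ `u = 0` a.e.;
* `Shifted.selfSimilar_ae_eq_zero_of_irrotationalC2_profile`, `Shifted.selfSimilar_ae_eq_zero_of_subdriftC2_profile` —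
  the shifted versions (`0 < ρ ≤ ½`).

WHAT THIS IS NOT: not NS, not E, not rung C1 — `C²` profiles with `limsup ‖V(y)‖/‖y‖ ≥ γ` that are not irrotational, the weak
class (`V ∉ C²`) and all non-self-similar members remain OPEN. [folklore; GilbargTrudinger2001 Thm 2.1 (mean value);
ChaeShvydkoy2013 §4 Thm 4.1 (setting: the irrotational endgame)]
-/

noncomputable section

-- flat `Theorems/<Route><Decl>…` files of one crux share the namespace of the crux (tree convention: `Summit.<S>.<S>.…`)
set_option linter.dupNamespace false

open MeasureTheory Set Filter Topology Metric Function InnerProductSpace TopologicalSpace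
open scoped RealInnerProductSpace NNReal ENNReal ContDiff Laplacian

namespace Summit.NavierStokesRegularity.NavierStokesRegularity.Theorems.PowerGaugeEulerLiouville

open Literature.Analysis Literature.Analysis.FunctionSpaces Literature.Analysis.FluidPDE

/-! ### The Liouville endgame without growth hypothesis -/

/-- **An irrotational incompressible `C²` field on `ℝ³` whose `L²`-mass in balls grows slower than the volume VANISHES**:
`curl V = 0`, `div V = 0`, `∫⁻_{B_L}‖V‖ₑ² ≤ C · L^θ` for all `L > 0` with `C < ∞`, `θ < 3` ⇒ `V = 0` (every component is harmonic,
`laplacian_eq_zero_of_curl_eq_zero_of_isDivFree`, and the growth form of Liouville's theorem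
`HarmonicOnNhd.eq_zero_of_lintegral_sq_le` applies since `|Vᵢ| ≤ ‖V‖`).  No pointwise growth hypothesis. [folklore;
GilbargTrudinger2001 Thm 2.1 (mean value)] -/
theorem Loc.eq_zero_of_curl_eq_zero_of_growth {V : EuclideanSpace ℝ (Fin 3) → EuclideanSpace ℝ (Fin 3)}
    (hV : ContDiff ℝ 2 V) (hcurl : ∀ x, curl V x = 0) (hdiv : VectorCalculus.IsDivFree V)
    {C : ℝ≥0∞} (hC : C ≠ ⊤) {θ : ℝ} (hθ : θ < 3)
    (hA : ∀ L : ℝ, 0 < L → ∫⁻ y in ball (0 : EuclideanSpace ℝ (Fin 3)) L, ‖V y‖ₑ ^ 2 ≤ C * ENNReal.ofReal (L ^ θ)) :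
    V = 0 := by
  have hΔ := laplacian_eq_zero_of_curl_eq_zero_of_isDivFree hV hcurl hdiv
  funext z
  ext i
  set η : EuclideanSpace ℝ (Fin 3) → ℝ := fun w => V w i with hη
  have hηeq : η = (EuclideanSpace.proj i : EuclideanSpace ℝ (Fin 3) →L[ℝ] ℝ) ∘ V := by funext w; rfl
  have hη2 : ContDiff ℝ 2 η := by
    rw [hηeq]; exact (EuclideanSpace.proj i : EuclideanSpace ℝ (Fin 3) →L[ℝ] ℝ).contDiff.comp hV
  have hηΔ : ∀ w, (Δ η) w = 0 := fun w => by
    rw [hηeq, hV.contDiffAt.laplacian_CLM_comp_left, Function.comp_apply, hΔ w, map_zero]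
  have hharm : HarmonicOnNhd η univ := harmonicOnNhd_of_laplacian_eq_zero hη2 hηΔ
  have hgr : ∀ L : ℝ, 0 < L →
      ∫⁻ w in ball (0 : EuclideanSpace ℝ (Fin 3)) L, ‖η w‖ₑ ^ 2 ≤ C * ENNReal.ofReal (L ^ θ) := by
    intro L hL
    refine le_trans (lintegral_mono fun w => ?_) (hA L hL)
    gcongr
    exact PiLp.enorm_apply_le (V w) i
  have hθ' : θ < Module.finrank ℝ (EuclideanSpace ℝ (Fin 3)) := by
    rw [finrank_euclideanSpace_fin]; exact_mod_cast hθ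
  have h0 := hharm.eq_zero_of_lintegral_sq_le hC hθ' hgr z
  simpa [hη] using h0

/-! ### Member level, centred: an irrotational `C²` profile is trivial, whatever its growth -/

/-- **AN EXACTLY SELF-SIMILAR MEMBER WITH IRROTATIONAL `C²` VELOCITY PROFILE IS TRIVIAL — NO GROWTH HYPOTHESIS** (`ρ > 0`).
Hypotheses: distributional Euler pair on `(−∞,0) × ℝ³` (only its weak divergence-freeness is used), the `A`-gauge
`a^{2ρ} A(a; 0) ≤ c`, exact self-similarity about the origin, `V ∈ C²`, `curl V ≡ 0`.  Then `div V = 0` classically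
(`ProfileEquation.profile_isWeaklyDivFree` + `IsWeaklyDivFree.isDivFree_of_contDiff`), `∫_{B_L}‖V‖² ≤ c L^{1−2ρ}`
(`profile_energy_growth_of_gaugeA`), and `Loc.eq_zero_of_curl_eq_zero_of_growth` gives `V = 0`.  No pressure, no profile equation.
[folklore] -/
theorem Loc.selfSimilar_ae_eq_zero_of_irrotationalC2_profile {ρ : ℝ} (hρ : 0 < ρ)
    {u : ℝ → EuclideanSpace ℝ (Fin 3) → EuclideanSpace ℝ (Fin 3)} {p : ℝ → EuclideanSpace ℝ (Fin 3) → ℝ} {c : ℝ≥0}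
    (hsol : IsDistributionalNSSolutionOn (slab (EuclideanSpace ℝ (Fin 3)) (Iio 0) isOpen_Iio) 0 0 u p)
    (hA : ∀ a : ℝ, 0 < a → ENNReal.ofReal (a ^ (2 * ρ)) *
      cknA a (0 : ℝ × EuclideanSpace ℝ (Fin 3)) u ≤ (c : ℝ≥0∞))
    {V : EuclideanSpace ℝ (Fin 3) → EuclideanSpace ℝ (Fin 3)}
    (hu : ∀ τ : ℝ, τ < 0 → u τ = selfSimilarCollapse (1 / (2 + ρ)) 0 V τ)
    (hV : ContDiff ℝ 2 V) (hcurl : ∀ x, curl V x = 0) :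
    uncurry u =ᵐ[volume.restrict (Iio (0 : ℝ) ×ˢ (univ : Set (EuclideanSpace ℝ (Fin 3))))] 0 := by
  have hdivw : IsWeaklyDivFree V :=
    ProfileEquation.profile_isWeaklyDivFree hsol hu hV.continuous.locallyIntegrable
  have hdiv : VectorCalculus.IsDivFree V := hdivw.isDivFree_of_contDiff (hV.of_le (by norm_num))
  have hgrowth := profile_energy_growth_of_gaugeA hρ hu hA
  have hV0 : V = 0 :=
    Loc.eq_zero_of_curl_eq_zero_of_growth hV hcurl hdiv ENNReal.coe_ne_top (θ := 1 - 2 * ρ) (by linarith) hgrowth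
  exact Kelvin.selfSimilar_ae_eq_zero_of_profile_eq_zero u hu hV0

namespace Shifted

/-! ### Member level, shifted: irrotational profiles and the sub-drift stratum -/

/-- **A member exactly self-similar about `(T, x₀)`, `T ≥ 0`, with IRROTATIONAL `C²` velocity profile is trivial** (`0 < ρ ≤ ½`;
no growth hypothesis): `div V = 0` from the origin-centred extension (`Shifted.isDistributional_selfSimilarCollapse_of_shifted` +
`ProfileEquation.profile_isWeaklyDivFree`), the `A`-gauge's large-scale reading `Shifted.profile_energy_growth_of_gaugeA` patched to all
scales (`Shifted.growth_of_growth_two_le`), and `Loc.eq_zero_of_curl_eq_zero_of_growth`. [folklore] -/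
theorem selfSimilar_ae_eq_zero_of_irrotationalC2_profile {ρ : ℝ} (hρ : 0 < ρ) (hρh : ρ ≤ 1 / 2) {T : ℝ} (hT : 0 ≤ T)
    (x₀ : EuclideanSpace ℝ (Fin 3))
    {u : ℝ → EuclideanSpace ℝ (Fin 3) → EuclideanSpace ℝ (Fin 3)} {p : ℝ → EuclideanSpace ℝ (Fin 3) → ℝ} {c : ℝ≥0}
    (hsol : IsDistributionalNSSolutionOn (slab (EuclideanSpace ℝ (Fin 3)) (Iio 0) isOpen_Iio) 0 0 u p)
    (hA : ∀ a : ℝ, 0 < a → ENNReal.ofReal (a ^ (2 * ρ)) *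
      cknA a (0 : ℝ × EuclideanSpace ℝ (Fin 3)) u ≤ (c : ℝ≥0∞))
    {V : EuclideanSpace ℝ (Fin 3) → EuclideanSpace ℝ (Fin 3)} {P : EuclideanSpace ℝ (Fin 3) → ℝ}
    (hu : ∀ τ : ℝ, τ < 0 → u τ = fun x => selfSimilarCollapse (1 / (2 + ρ)) T V τ (x - x₀))
    (hp : ∀ τ : ℝ, τ < 0 → p τ = fun x => selfSimilarCollapsePressure (1 / (2 + ρ)) T P τ (x - x₀))
    (hV : ContDiff ℝ 2 V) (hcurl : ∀ x, curl V x = 0) :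
    uncurry u =ᵐ[volume.restrict (Iio (0 : ℝ) ×ˢ (univ : Set (EuclideanSpace ℝ (Fin 3))))] 0 := by
  -- divergence-freeness of the profile from the extension
  have hext := isDistributional_selfSimilarCollapse_of_shifted hT x₀ hsol hu hp
  have hdivw : IsWeaklyDivFree V :=
    ProfileEquation.profile_isWeaklyDivFree hext (fun _ _ => rfl) hV.continuous.locallyIntegrable
  have hdiv : VectorCalculus.IsDivFree V := hdivw.isDivFree_of_contDiff (hV.of_le (by norm_num))
  -- the member's own `A`-gauge at large profile scales, all scales by the local bound
  obtain ⟨C, hC, hgrowth⟩ := profile_energy_growth_of_gaugeA hρ hρh hT x₀ hu hA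
  obtain ⟨C', hC', hgrowth'⟩ := growth_of_growth_two_le hV.continuous (θ := 1 - 2 * ρ) (by linarith) hC hgrowth
  have hV0 : V = 0 :=
    Loc.eq_zero_of_curl_eq_zero_of_growth hV hcurl hdiv hC' (θ := 1 - 2 * ρ) (by linarith) hgrowth'
  -- conclusion
  have hS : MeasurableSet (Iio (0 : ℝ) ×ˢ (univ : Set (EuclideanSpace ℝ (Fin 3)))) :=
    measurableSet_Iio.prod MeasurableSet.univ
  refine (ae_restrict_mem hS).mono fun z hz => ?_
  obtain ⟨hτ, -⟩ := hz
  have hτ' : z.1 < 0 := hτ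
  change u z.1 z.2 = 0
  rw [hu z.1 hτ']
  simp [selfSimilarCollapse_apply, hV0]

/-- **THE SHIFTED SUB-DRIFT STRATUM, MEMBER LEVEL** (`0 < ρ ≤ ½`, the window).  Let `(u, p)` be a distributional Euler pair on
`(−∞,0) × ℝ³` with `a^{2ρ} A(a; 0) ≤ c` for all `a > 0`, exactly self-similar about the space–time point `(T, x₀)`, `T ≥ 0`, with
the class exponent `γ = 1/(2+ρ)` and profile `(V, P)`.  If `V ∈ C²` and `‖V y‖ ≤ κ‖y‖` for `‖y‖ ≥ R₁` with some `κ < γ`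
(`limsup ‖V(y)‖/‖y‖ < γ`: the profile is slower than the similarity drift at infinity), then `u = 0` a.e.: CIV (3.3) classically
for some `C¹` pressure on the extension (`WeakToClassical.exists_isSelfSimilarEulerProfile_of_contDiff`), `curl V ≡ 0` by
ns-typeII-p1 g8's `Loc.curl_eq_zero_of_subdrift`, and the irrotational case above.  Shifted twin of p1 g8's
`Loc.selfSimilar_ae_eq_zero_of_subdriftC2_profile`; contains the shifted sublinear / uniformly continuous / bounded strata.
[folklore] -/
theorem selfSimilar_ae_eq_zero_of_subdriftC2_profile {ρ : ℝ} (hρ : 0 < ρ) (hρh : ρ ≤ 1 / 2) {T : ℝ} (hT : 0 ≤ T)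
    (x₀ : EuclideanSpace ℝ (Fin 3))
    {u : ℝ → EuclideanSpace ℝ (Fin 3) → EuclideanSpace ℝ (Fin 3)} {p : ℝ → EuclideanSpace ℝ (Fin 3) → ℝ} {c : ℝ≥0}
    (hsol : IsDistributionalNSSolutionOn (slab (EuclideanSpace ℝ (Fin 3)) (Iio 0) isOpen_Iio) 0 0 u p)
    (hA : ∀ a : ℝ, 0 < a → ENNReal.ofReal (a ^ (2 * ρ)) *
      cknA a (0 : ℝ × EuclideanSpace ℝ (Fin 3)) u ≤ (c : ℝ≥0∞))
    {V : EuclideanSpace ℝ (Fin 3) → EuclideanSpace ℝ (Fin 3)} {P : EuclideanSpace ℝ (Fin 3) → ℝ}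
    (hu : ∀ τ : ℝ, τ < 0 → u τ = fun x => selfSimilarCollapse (1 / (2 + ρ)) T V τ (x - x₀))
    (hp : ∀ τ : ℝ, τ < 0 → p τ = fun x => selfSimilarCollapsePressure (1 / (2 + ρ)) T P τ (x - x₀))
    (hV : ContDiff ℝ 2 V) {κ R₁ : ℝ} (hκ : κ < 1 / (2 + ρ))
    (hfar : ∀ y : EuclideanSpace ℝ (Fin 3), R₁ ≤ ‖y‖ → ‖V y‖ ≤ κ * ‖y‖) :
    uncurry u =ᵐ[volume.restrict (Iio (0 : ℝ) ×ˢ (univ : Set (EuclideanSpace ℝ (Fin 3))))] 0 := by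
  have h2ρ : (0 : ℝ) < 2 + ρ := by linarith
  have hγ : (0 : ℝ) < 1 / (2 + ρ) := one_div_pos.2 h2ρ
  have hγ2 : 1 / (2 + ρ) < 1 / 2 := one_div_lt_one_div_of_lt two_pos (by linarith)
  -- the extension, `P ∈ L¹_loc`, CIV (3.3) classically
  have hext := isDistributional_selfSimilarCollapse_of_shifted hT x₀ hsol hu hp
  have hpm : AEStronglyMeasurable (uncurry (selfSimilarCollapsePressure (1 / (2 + ρ)) 0 P))
      (volume.restrict (Iio (0 : ℝ) ×ˢ (univ : Set (EuclideanSpace ℝ (Fin 3))))) := by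
    have := hext.2.2.1.aestronglyMeasurable
    simpa [slab] using this
  have hPm : AEStronglyMeasurable P volume :=
    aestronglyMeasurable_pressureProfile (p := selfSimilarCollapsePressure (1 / (2 + ρ)) 0 P) hpm fun _ _ => rfl
  have hP1 : LocallyIntegrable P volume :=
    locallyIntegrable_pressureProfile_of_slab hγ.le (by linarith) hPm hext.2.2.1
  obtain ⟨P', hprof⟩ := WeakToClassical.exists_isSelfSimilarEulerProfile_of_contDiff hext
    (fun _ _ => rfl) (fun _ _ => rfl) hV hP1
  -- irrotational by the sub-drift barrier (ns-typeII-p1 g8)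
  have hcurl : ∀ x, curl V x = 0 := fun x => Loc.curl_eq_zero_of_subdrift hprof hκ hfar hγ hγ2 x
  exact selfSimilar_ae_eq_zero_of_irrotationalC2_profile hρ hρh hT x₀ hsol hA hu hp hV hcurl

end Shifted

end Summit.NavierStokesRegularity.NavierStokesRegularity.Theorems.PowerGaugeEulerLiouville

end
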